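import Mathlib.NumberTheory.ZetaValues
import Mathlib.Topology.Instances.AddCircle.Real
import Mathlib.GroupTheory.Index
import Mathlib.Algebra.Order.Chebyshev
import Literature.NumberTheory.EllipticCurves.LangHeightNonarchEstimate
import Literature.NumberTheory.EllipticCurves.NeronLocalHeightBadPlaces
import Literature.NumberTheory.EllipticCurves.TamagawaNeZeroProofs
import Literature.NumberTheory.DiophantineGeometry.LocalReductionProofs
import HarnessLib

/-!
# Petsche's Lemma 3: the counting-and-Fourier argument, separated from the local height theory

Topic `NumberTheory/EllipticCurves` (family `abc`, G06). Proof layer below the named fact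
`Literature.NumberTheory.EllipticCurves.Petsche2006_lemma3` (file `LangHeightNonarchEstimate.lean`;
C. Petsche, *Small rational points on elliptic curves over number fields*, New York J. Math. 12
(2006), Lemma 3, arXiv math/0508160 pp. 4–6): for a non-archimedean place `v` and `N` distinct
points `Z`, `Λ_v(Z) = N⁻² Σ_{i ≠ j} λ_v(P_i − P_j) ≥ (1/c_v² − 1/N)(1/12) log|1/Δ_v|_v`.

The printed proof has two layers:

1. *local height theory* (Petsche, §2, displays (11)–(12); Silverman, ATAEC VI.4.1–VI.4.2, Tate's
   uniformisation): the decomposition `λ_v(P − Q) = i_v(P, Q) + j_v(P, Q)` with `i_v ≥ 0`,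
   `i_v ≥ (1/12)(log|1/Δ_v|_v − log⁺|j_E|_v)` for `P − Q ∈ E₀(k_v) ∖ {O}`, and
   `j_v = ½ B₂(r(P − Q)) log⁺|j_E|_v` for a homomorphism `r : E(k_v) → ℝ/ℤ` killing `E₀(k_v)`
   (`r = 0` when `|j_E|_v ≤ 1`), where `|E(k_v)/E₀(k_v)| = c_v`;
2. *counting and Fourier analysis* (displays (13)–(18)): the ordered pairs with `P_i − P_j ∈ E₀`
   number `M = Σ_C N_C² ≥ N²/c_v`, and
   `Σ_{i,j} B₂(r(P_i) − r(P_j)) ≥ N²/(6 c_v²)` because `r(E(k_v)) ⊆ ⟨1/c_v⟩` and the Fourier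
   coefficients of `B₂` are positive.

This file **proves layer 2 in abstract form** (`Petsche2006.lemma3_abstract`: any abelian group
`G`, subgroup `H` of index dividing `c`, function `λ : G → ℝ` and homomorphism `r : G → ℝ/ℤ`
with the three inequalities of layer 1 as hypotheses), with a *finite* proof of the positivity of
the `B₂`-kernel on `⟨1/c⟩ ⊂ ℝ/ℤ` (`Petsche2006.sq_sum_div_le_sum_sum_mul_mul_periodizedBernoulli`:
writing the weights as `N/c + d_a`, the rows of the kernel sum to `Σ_k B₂(k/c) = 1/(6c)` and the
`d`-part is a variance, `(2/c²)(c Σ D_k² − (Σ D_k)²) ≥ 0` in the tail sums `D_k`), and then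
**reduces the named fact `Petsche2006_lemma3` to layer 1**
(`Petsche2006_lemma3_of_localStructure`): for every elliptic `W/ℚ` and finite place `v` it
remains to produce a subgroup `H ≤ E(ℚ)` (the rational points landing in `E₀(ℚ_v)` of the local
minimal model) of index dividing `c_v = W.tamagawaNumberAt v`, a real `0 ≤ J ≤ ord_v(Δ_min) log p_v`
(`J = log⁺|j_E|_v`) and a homomorphism `r : E(ℚ) → ℝ/ℤ` vanishing on `H` with
`λ_v ≥ (1/12) ord_v(Δ_min) log p_v` on `H ∖ {O}` (ATAEC VI.4.1, proved for Tate's `λ` in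
`NeronLocalHeightIdentityComponent.lean`) and `λ_v(P) ≥ ½ 𝐁₂(r(P)) J` for `P ≠ O` (potential good
reduction when `J = 0`; Tate's uniformisation, ATAEC VI.4.2, when `J > 0`).

## Design notes

* Pure proofs, no new definitions or facts. `ℝ/ℤ = UnitAddCircle`, `𝐁₂ = periodizedBernoulli 2`
  (Mathlib), as in `NeronLocalHeightBadPlaces.lean`, whose named fact
  `exists_bernoulli_le_neronLocalHeight_of_hasSplitMultiplicativeReductionAt` has the shape of the
  third hypothesis at the split multiplicative places. The `c`-torsion of `ℝ/ℤ` is parametrised by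
  Mathlib's `ZMod.toAddCircle`.
* Namespace `Literature.NumberTheory.EllipticCurves.Petsche2006` (grouping namespace of the paper,
  as in `LangHeightSzpiroRatio.lean`, `LangHeightSmallPoints.lean`); the reduction theorem itself is
  `Literature.NumberTheory.EllipticCurves.Petsche2006_lemma3_of_localStructure`.
* Mathlib / tree search: `lean search 'periodizedBernoulli'` — only `NeronLocalHeightBadPlaces.lean`
  (the unfolding lemmas `periodizedBernoulli_two_coe`, `periodizedBernoulli_two_zero`, reused); no
  positivity statement for the `B₂`-kernel in Mathlib or the tree.

## References

* C. Petsche, *Small rational points on elliptic curves over number fields*, New York J. Math. 12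
  (2006), 257–268; arXiv math/0508160: Lemma 3 and its proof (displays (11)–(18)).
* M. Hindry, J. H. Silverman, *On Lehmer's conjecture for elliptic curves*, Sém. Théorie des
  Nombres Paris 1988–89, Progr. Math. 91 (1990), 103–116, Prop. 1.2.
* J. H. Silverman, *Advanced Topics in the Arithmetic of Elliptic Curves*, GTM 151 (1994),
  Thm. VI.4.1, Thm. VI.4.2.
-/

noncomputable section

open scoped Classical

open Finset

namespace Literature.NumberTheory.EllipticCurves

namespace Petsche2006

/-! ### The periodic second Bernoulli function on `ℝ/ℤ` -/

/-- Closed form of `𝐁₂(x − y)` for `x, y ∈ [0, 1)`: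
`𝐁₂(x − y) = 2 min{x, y} − 2xy + (x² − x) + (y² − y) + 1/6`. [folklore] -/
theorem periodizedBernoulli_two_coe_sub_coe {x y : ℝ} (hx : x ∈ Set.Ico (0 : ℝ) 1)
    (hy : y ∈ Set.Ico (0 : ℝ) 1) :
    periodizedBernoulli 2 ((x : UnitAddCircle) - (y : UnitAddCircle)) =
      2 * min x y - 2 * x * y + (x ^ 2 - x) + (y ^ 2 - y) + 1 / 6 := by
  rw [← AddCircle.coe_sub]
  rcases le_or_gt y x with hxy | hxy
  · rw [periodizedBernoulli_two_coe (sub_nonneg.mpr hxy) (by linarith [hx.2, hy.1]),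
      min_eq_right hxy]
    ring
  · rw [← AddCircle.coe_add_period 1 (x - y),
      periodizedBernoulli_two_coe (by linarith [hx.1, hy.2]) (by linarith),
      min_eq_left hxy.le]
    ring

/-- `Σ_{k < c} B₂(k/c) = 1/(6c)` (the multiplication theorem for `B₂` at `x = 0`). [folklore] -/
theorem sum_range_bernoulliFun_two_div {c : ℕ} (hc : c ≠ 0) :
    ∑ k ∈ range c, bernoulliFun 2 ((k : ℝ) / c) = 1 / (6 * c) := by
  have h := bernoulliFun_mul 2 hc 0
  simp only [mul_zero, zero_add, bernoulliFun_two] at h ⊢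
  have hc' : (c : ℝ) ≠ 0 := Nat.cast_ne_zero.mpr hc
  have h2 : (c : ℝ) ^ 2 / c = c := by rw [sq, mul_div_assoc, div_self hc', mul_one]
  rw [h2] at h
  field_simp at h ⊢
  linarith

/-! ### `𝐁₂` on the `c`-torsion of `ℝ/ℤ`: reduction to `ZMod c` -/

variable {c : ℕ} [NeZero c]

/-- `(a.val : ℝ)/c ∈ [0, 1)` for `a : ZMod c`. [folklore] -/
theorem val_div_mem_Ico (a : ZMod c) : ((a.val : ℝ) / c) ∈ Set.Ico (0 : ℝ) 1 := by
  have hc : (0 : ℝ) < c := Nat.cast_pos.mpr (NeZero.pos c)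
  exact ⟨by positivity, (div_lt_one hc).mpr (by exact_mod_cast ZMod.val_lt a)⟩

/-- `𝐁₂(a/c − b/c) = B₂((a − b).val / c)` on `ZMod c ⊂ ℝ/ℤ`. [folklore] -/
theorem periodizedBernoulli_two_toAddCircle_sub (a b : ZMod c) :
    periodizedBernoulli 2 (ZMod.toAddCircle a - ZMod.toAddCircle b) =
      bernoulliFun 2 (((a - b).val : ℝ) / c) := by
  rw [← map_sub, ZMod.toAddCircle_apply,
    periodizedBernoulli_two_coe (val_div_mem_Ico (a - b)).1 (val_div_mem_Ico (a - b)).2,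
    bernoulliFun_two]
  norm_num

/-- Column sums of the circulant `𝐁₂((a − b)/c)`: `Σ_a 𝐁₂(a/c − b/c) = 1/(6c)`. [folklore] -/
theorem sum_periodizedBernoulli_two_toAddCircle_sub (b : ZMod c) :
    ∑ a : ZMod c, periodizedBernoulli 2 (ZMod.toAddCircle a - ZMod.toAddCircle b) = 1 / (6 * c) := by
  simp_rw [periodizedBernoulli_two_toAddCircle_sub]
  rw [← Equiv.sum_comp (Equiv.addRight b) ]
  simp only [Equiv.coe_addRight, add_sub_cancel_right]
  rw [← sum_range_bernoulliFun_two_div (NeZero.ne c)]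
  refine Finset.sum_nbij' (fun a => a.val) (fun k => (k : ZMod c)) (fun a _ => ?_) (fun k hk => ?_)
    (fun a _ => ?_) (fun k hk => ?_) (fun a _ => rfl)
  · exact mem_range.mpr (ZMod.val_lt a)
  · exact mem_univ _
  · exact ZMod.natCast_zmod_val a
  · exact ZMod.val_cast_of_lt (mem_range.mp hk)

/-- Row sums: `Σ_b 𝐁₂(a/c − b/c) = 1/(6c)`. [folklore] -/
theorem sum_periodizedBernoulli_two_toAddCircle_sub' (a : ZMod c) :
    ∑ b : ZMod c, periodizedBernoulli 2 (ZMod.toAddCircle a - ZMod.toAddCircle b) = 1 / (6 * c) := by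
  simp_rw [periodizedBernoulli_two_toAddCircle_sub]
  rw [← Equiv.sum_comp (Equiv.subLeft a)]
  simp only [Equiv.subLeft_apply, sub_sub_cancel]
  rw [← sum_range_bernoulliFun_two_div (NeZero.ne c)]
  refine Finset.sum_nbij' (fun a => a.val) (fun k => (k : ZMod c)) (fun a _ => ?_) (fun k hk => ?_)
    (fun a _ => ?_) (fun k hk => ?_) (fun a _ => rfl)
  · exact mem_range.mpr (ZMod.val_lt a)
  · exact mem_univ _
  · exact ZMod.natCast_zmod_val a
  · exact ZMod.val_cast_of_lt (mem_range.mp hk)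


/-! ### Positivity of the `𝐁₂`-kernel on `ZMod c` (Petsche 2006, proof of Lemma 3, display (18)) -/

omit [NeZero c] in
/-- `min{m, n} = #{k < c | k < m ∧ k < n}` for `m ≤ c`. [folklore] -/
theorem natCast_min_eq_sum_range_ite {m n : ℕ} (hm : m ≤ c) :
    ((min m n : ℕ) : ℝ) = ∑ k ∈ range c, if k < m ∧ k < n then (1 : ℝ) else 0 := by
  rw [Finset.sum_boole]
  have : (range c).filter (fun k => k < m ∧ k < n) = range (min m n) := by
    ext k
    simp only [mem_filter, mem_range, lt_min_iff]
    constructor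
    · rintro ⟨-, h⟩; exact h
    · rintro h; exact ⟨lt_of_lt_of_le h.1 hm, h⟩
  rw [this, card_range]

omit [NeZero c] in
/-- `m = #{k < c | k < m}` for `m ≤ c`. [folklore] -/
theorem natCast_eq_sum_range_ite {m : ℕ} (hm : m ≤ c) :
    (m : ℝ) = ∑ k ∈ range c, if k < m then (1 : ℝ) else 0 := by
  rw [Finset.sum_boole]
  have : (range c).filter (fun k => k < m) = range m := by
    ext k
    simp only [mem_filter, mem_range]
    constructor
    · rintro ⟨-, h⟩; exact h
    · rintro h; exact ⟨lt_of_lt_of_le h hm, h⟩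
  rw [this, card_range]

omit [NeZero c] in
/-- `Σ_k (Σ_a f_k(a))² = Σ_a Σ_b Σ_k f_k(a) f_k(b)`. [folklore] -/
theorem sum_sq_sum_eq {α : Type*} [Fintype α] (f : ℕ → α → ℝ) :
    ∑ k ∈ range c, (∑ a, f k a) ^ 2 = ∑ a, ∑ b, ∑ k ∈ range c, f k a * f k b := by
  simp_rw [sq, Finset.sum_mul_sum]
  rw [Finset.sum_comm]
  exact Finset.sum_congr rfl fun a _ => Finset.sum_comm

/-- **The variance form.** For real weights `d` on `ZMod c` with `Σ d = 0`,
`Σ_{a,b} d_a d_b 𝐁₂(a/c − b/c) = (2/c²) (c Σ_k D_k² − (Σ_k D_k)²) ≥ 0`, where `D_k = Σ_{a : k < a} d_a`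
(`0 ≤ k < c`) are the tail sums: the quadratic form of the periodic second Bernoulli function is
positive semi-definite on weights of total mass zero. [folklore] -/
theorem sum_sum_mul_mul_periodizedBernoulli_nonneg_of_sum_eq_zero (d : ZMod c → ℝ)
    (hd : ∑ a, d a = 0) :
    0 ≤ ∑ a : ZMod c, ∑ b : ZMod c,
      d a * d b * periodizedBernoulli 2 (ZMod.toAddCircle a - ZMod.toAddCircle b) := by
  have hc0 : (0 : ℝ) < c := Nat.cast_pos.mpr (NeZero.pos c)
  have hcne : (c : ℝ) ≠ 0 := hc0.ne'
  -- the indicator `χ k a = [k < a.val]` and the tail sums `D k = Σ_a χ k a • d a`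
  set χ : ℕ → ZMod c → ℝ := fun k a => if k < a.val then 1 else 0 with hχ
  set D : ℕ → ℝ := fun k => ∑ a, χ k a * d a with hD
  have hχχ : ∀ a b : ZMod c, (∑ k ∈ range c, χ k a * χ k b) = ((min a.val b.val : ℕ) : ℝ) := by
    intro a b
    rw [natCast_min_eq_sum_range_ite (ZMod.val_lt a).le]
    refine Finset.sum_congr rfl fun k _ => ?_
    by_cases ha : k < a.val <;> by_cases hb : k < b.val <;> simp [hχ, ha, hb]
  have hval : ∀ a : ZMod c, (a.val : ℝ) = ∑ k ∈ range c, χ k a := fun a => by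
    rw [natCast_eq_sum_range_ite (ZMod.val_lt a).le]
  -- closed form of the kernel
  have hker : ∀ a b : ZMod c,
      periodizedBernoulli 2 (ZMod.toAddCircle a - ZMod.toAddCircle b) =
        2 / c * (∑ k ∈ range c, χ k a * χ k b) - 2 / c ^ 2 * ((a.val : ℝ) * b.val) +
          (((a.val : ℝ) / c) ^ 2 - a.val / c) + (((b.val : ℝ) / c) ^ 2 - b.val / c) + 1 / 6 := by
    intro a b
    rw [ZMod.toAddCircle_apply, ZMod.toAddCircle_apply,
      periodizedBernoulli_two_coe_sub_coe (val_div_mem_Ico a) (val_div_mem_Ico b), hχχ,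
      Nat.cast_min, min_div_div_right hc0.le]
    field_simp
  -- the four pieces of the expansion
  have h1 : ∑ a : ZMod c, ∑ b : ZMod c, d a * d b * (2 / c * ∑ k ∈ range c, χ k a * χ k b) =
      2 / c * ∑ k ∈ range c, D k ^ 2 := by
    rw [sum_sq_sum_eq, Finset.mul_sum]
    refine Finset.sum_congr rfl fun a _ => ?_
    rw [Finset.mul_sum]
    refine Finset.sum_congr rfl fun b _ => ?_
    rw [Finset.mul_sum, Finset.mul_sum, Finset.mul_sum]
    exact Finset.sum_congr rfl fun k _ => by ring
  have h2 : ∑ a : ZMod c, ∑ b : ZMod c, d a * d b * (2 / c ^ 2 * ((a.val : ℝ) * b.val)) =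
      2 / c ^ 2 * (∑ k ∈ range c, D k) ^ 2 := by
    have hS : ∑ k ∈ range c, D k = ∑ a, (a.val : ℝ) * d a := by
      simp only [hD]
      rw [Finset.sum_comm]
      refine Finset.sum_congr rfl fun a _ => ?_
      rw [hval a, Finset.sum_mul]
    have hsq : (∑ a, (a.val : ℝ) * d a) ^ 2 = ∑ a, ∑ b, ((a.val : ℝ) * d a) * ((b.val : ℝ) * d b) := by
      rw [sq, Finset.sum_mul_sum]
    rw [hS, hsq, Finset.mul_sum]
    refine Finset.sum_congr rfl fun a _ => ?_
    rw [Finset.mul_sum]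
    exact Finset.sum_congr rfl fun b _ => by ring
  have h3 : ∑ a : ZMod c, ∑ b : ZMod c,
      d a * d b * ((((a.val : ℝ) / c) ^ 2 - a.val / c)) = 0 := by
    have : ∀ a : ZMod c, ∑ b : ZMod c, d a * d b * ((((a.val : ℝ) / c) ^ 2 - a.val / c)) =
        d a * ((((a.val : ℝ) / c) ^ 2 - a.val / c)) * ∑ b, d b := fun a => by
      rw [Finset.mul_sum]
      exact Finset.sum_congr rfl fun b _ => by ring
    simp_rw [this, hd, mul_zero, Finset.sum_const_zero]
  have h4 : ∑ a : ZMod c, ∑ b : ZMod c,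
      d a * d b * ((((b.val : ℝ) / c) ^ 2 - b.val / c)) = 0 := by
    rw [Finset.sum_comm]
    have : ∀ b : ZMod c, ∑ a : ZMod c, d a * d b * ((((b.val : ℝ) / c) ^ 2 - b.val / c)) =
        d b * ((((b.val : ℝ) / c) ^ 2 - b.val / c)) * ∑ a, d a := fun b => by
      rw [Finset.mul_sum]
      exact Finset.sum_congr rfl fun a _ => by ring
    simp_rw [this, hd, mul_zero, Finset.sum_const_zero]
  have h5 : ∑ a : ZMod c, ∑ b : ZMod c, d a * d b * (1 / 6 : ℝ) = 0 := by
    have : ∑ a : ZMod c, ∑ b : ZMod c, d a * d b * (1 / 6 : ℝ) =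
        (∑ a, d a) * (∑ b, d b) * (1 / 6) := by
      rw [Finset.sum_mul_sum, Finset.sum_mul]
      refine Finset.sum_congr rfl fun a _ => ?_
      rw [Finset.sum_mul]
    rw [this, hd, zero_mul, zero_mul]
  have hexp : ∑ a : ZMod c, ∑ b : ZMod c,
      d a * d b * periodizedBernoulli 2 (ZMod.toAddCircle a - ZMod.toAddCircle b) =
        2 / c * ∑ k ∈ range c, D k ^ 2 - 2 / c ^ 2 * (∑ k ∈ range c, D k) ^ 2 := by
    have : ∀ a b : ZMod c,
        d a * d b * periodizedBernoulli 2 (ZMod.toAddCircle a - ZMod.toAddCircle b) =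
        d a * d b * (2 / c * ∑ k ∈ range c, χ k a * χ k b) -
          d a * d b * (2 / c ^ 2 * ((a.val : ℝ) * b.val)) +
          d a * d b * ((((a.val : ℝ) / c) ^ 2 - a.val / c)) +
          d a * d b * ((((b.val : ℝ) / c) ^ 2 - b.val / c)) +
          d a * d b * (1 / 6 : ℝ) := fun a b => by rw [hker]; ring
    simp_rw [this, Finset.sum_add_distrib, Finset.sum_sub_distrib, h1, h2, h3, h4, h5]
    ring
  rw [hexp]
  -- Cauchy–Schwarz over `range c`
  have hCS : (∑ k ∈ range c, D k) ^ 2 ≤ (c : ℝ) * ∑ k ∈ range c, D k ^ 2 := by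
    have := sq_sum_le_card_mul_sum_sq (s := range c) (f := D)
    rwa [card_range] at this
  have : 2 / (c : ℝ) * ∑ k ∈ range c, D k ^ 2 - 2 / c ^ 2 * (∑ k ∈ range c, D k) ^ 2 =
      2 / c ^ 2 * ((c : ℝ) * ∑ k ∈ range c, D k ^ 2 - (∑ k ∈ range c, D k) ^ 2) := by
    field_simp
  rw [this]
  exact mul_nonneg (by positivity) (sub_nonneg.mpr hCS)

/-- **Positivity of the `𝐁₂`-kernel on `(1/c)ℤ/ℤ`** (the finite form of the Fourier argument of
Petsche 2006, proof of Lemma 3, display (18): the Fourier coefficients of `B₂` are positive). For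
arbitrary real weights `N_a`, `a ∈ ℤ/cℤ`,
`Σ_{a,b} N_a N_b 𝐁₂(a/c − b/c) ≥ (Σ_a N_a)² / (6c²)`: writing `N_a = N/c + d_a` with `Σ d = 0`,
the cross terms vanish because every row and column of the kernel sums to `Σ_k B₂(k/c) = 1/(6c)`,
the constant part contributes exactly `N²/(6c²)`, and the `d`-part is non-negative
(`sum_sum_mul_mul_periodizedBernoulli_nonneg_of_sum_eq_zero`). [cite: Petsche2006, proof of Lemma 3] -/
theorem sq_sum_div_le_sum_sum_mul_mul_periodizedBernoulli (N : ZMod c → ℝ) :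
    (∑ a, N a) ^ 2 / (6 * (c : ℝ) ^ 2) ≤
      ∑ a : ZMod c, ∑ b : ZMod c,
        N a * N b * periodizedBernoulli 2 (ZMod.toAddCircle a - ZMod.toAddCircle b) := by
  have hc0 : (0 : ℝ) < c := Nat.cast_pos.mpr (NeZero.pos c)
  have hcne : (c : ℝ) ≠ 0 := hc0.ne'
  have hcard : (Finset.univ : Finset (ZMod c)).card = c := by rw [Finset.card_univ, ZMod.card]
  set S := ∑ a, N a with hS
  set n := S / c with hn
  set d : ZMod c → ℝ := fun a => N a - n with hd
  have hdsum : ∑ a, d a = 0 := by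
    show ∑ a, (N a - n) = 0
    rw [Finset.sum_sub_distrib, Finset.sum_const, hcard, nsmul_eq_mul, ← hS, hn]
    field_simp
    ring
  set e : ZMod c → ZMod c → ℝ := fun a b =>
    periodizedBernoulli 2 (ZMod.toAddCircle a - ZMod.toAddCircle b) with he
  have hrow : ∀ a, ∑ b, e a b = 1 / (6 * c) := fun a =>
    sum_periodizedBernoulli_two_toAddCircle_sub' a
  have hcol : ∀ b, ∑ a, e a b = 1 / (6 * c) := fun b =>
    sum_periodizedBernoulli_two_toAddCircle_sub b
  have hN : ∀ a, N a = n + d a := fun a => by simp [hd]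
  have hsplit : ∀ a b, N a * N b * e a b =
      n ^ 2 * e a b + n * (d a * e a b) + n * (d b * e a b) + d a * d b * e a b := fun a b => by
    rw [hN a, hN b]; ring
  have e1 : ∑ a, ∑ b, n ^ 2 * e a b = n ^ 2 * ∑ a, ∑ b, e a b := by simp_rw [Finset.mul_sum]
  have e2 : ∑ a, ∑ b, n * (d a * e a b) = n * ∑ a, d a * ∑ b, e a b := by
    simp_rw [Finset.mul_sum]
  have e3 : ∑ a, ∑ b, n * (d b * e a b) = n * ∑ b, d b * ∑ a, e a b := by
    rw [Finset.sum_comm]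
    simp_rw [Finset.mul_sum]
  have hconst : n ^ 2 * ∑ a, ∑ b, e a b = S ^ 2 / (6 * c ^ 2) := by
    simp_rw [hrow, Finset.sum_const, hcard, nsmul_eq_mul, hn]
    field_simp
  have hcross1 : n * ∑ a, d a * ∑ b, e a b = 0 := by
    simp_rw [hrow, ← Finset.sum_mul, hdsum, zero_mul, mul_zero]
  have hcross2 : n * ∑ b, d b * ∑ a, e a b = 0 := by
    simp_rw [hcol, ← Finset.sum_mul, hdsum, zero_mul, mul_zero]
  have hpos := sum_sum_mul_mul_periodizedBernoulli_nonneg_of_sum_eq_zero d hdsum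
  change S ^ 2 / (6 * (c : ℝ) ^ 2) ≤ ∑ a, ∑ b, N a * N b * e a b
  simp_rw [hsplit, Finset.sum_add_distrib]
  rw [e1, e2, e3, hconst, hcross1, hcross2]
  linarith

/-! ### From the `c`-torsion of `ℝ/ℤ` to `ZMod c`, and the point form of the positivity -/

/-- An element of `ℝ/ℤ` killed by `c ≠ 0` is of the form `k/c`, `k ∈ ℤ/cℤ`. [folklore] -/
theorem exists_toAddCircle_eq_of_nsmul_eq_zero {u : UnitAddCircle} (hu : c • u = 0) :
    ∃ k : ZMod c, ZMod.toAddCircle k = u := by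
  obtain ⟨⟨x, hx⟩, rfl⟩ : ∃ y : Set.Ico (0 : ℝ) (0 + 1), ((y : ℝ) : UnitAddCircle) = u :=
    ⟨AddCircle.equivIco 1 0 u, AddCircle.coe_equivIco⟩
  have h : ((c • x : ℝ) : UnitAddCircle) = 0 := by rw [AddCircle.coe_nsmul]; exact hu
  obtain ⟨n, hn⟩ := (AddCircle.coe_eq_zero_iff (1 : ℝ)).mp h
  rw [zsmul_eq_mul, mul_one, nsmul_eq_mul] at hn
  have hcne : (c : ℝ) ≠ 0 := Nat.cast_ne_zero.mpr (NeZero.ne c)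
  refine ⟨(n : ZMod c), ?_⟩
  rw [ZMod.toAddCircle_intCast, hn, mul_div_cancel_left₀ _ hcne]

/-- **Point form of the positivity** (Petsche 2006, proof of Lemma 3, display (18), with the
rationality `r(E(k_v)) ⊆ ⟨1/c_v⟩`): for a finite family of points `t_i ∈ ℝ/ℤ` all killed by `c`,
`Σ_{i,j ∈ Z} 𝐁₂(t_i − t_j) ≥ |Z|² / (6c²)`. [cite: Petsche2006, proof of Lemma 3] -/
theorem card_sq_div_le_sum_sum_periodizedBernoulli {ι : Type*} (Z : Finset ι)
    (t : ι → UnitAddCircle) (ht : ∀ i ∈ Z, c • t i = 0) :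
    (Z.card : ℝ) ^ 2 / (6 * (c : ℝ) ^ 2) ≤
      ∑ i ∈ Z, ∑ j ∈ Z, periodizedBernoulli 2 (t i - t j) := by
  classical
  -- residues `k i : ZMod c` with `t i = k i / c` on `Z`
  have hk : ∀ i, ∃ k : ZMod c, i ∈ Z → ZMod.toAddCircle k = t i := fun i => by
    by_cases hi : i ∈ Z
    · obtain ⟨k, hk⟩ := exists_toAddCircle_eq_of_nsmul_eq_zero (ht i hi)
      exact ⟨k, fun _ => hk⟩
    · exact ⟨0, fun h => (hi h).elim⟩
  choose k hk using hk
  set e : ZMod c → ZMod c → ℝ := fun a b =>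
    periodizedBernoulli 2 (ZMod.toAddCircle a - ZMod.toAddCircle b) with he
  set N : ZMod c → ℝ := fun a => ((Z.filter fun i => k i = a).card : ℝ) with hN
  have hrew : ∑ i ∈ Z, ∑ j ∈ Z, periodizedBernoulli 2 (t i - t j) =
      ∑ i ∈ Z, ∑ j ∈ Z, e (k i) (k j) :=
    Finset.sum_congr rfl fun i hi => Finset.sum_congr rfl fun j hj => by
      simp only [he, hk i hi, hk j hj]
  -- fibrewise regrouping: `Σ_{i ∈ Z} g (k i) = Σ_a N_a g a`
  have hfib : ∀ g : ZMod c → ℝ, ∑ i ∈ Z, g (k i) = ∑ a, N a * g a := fun g => by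
    rw [← Finset.sum_fiberwise_of_maps_to (s := Z) (t := Finset.univ) (g := k)
      (fun i _ => Finset.mem_univ _)]
    refine Finset.sum_congr rfl fun a _ => ?_
    rw [Finset.sum_congr rfl (fun i hi => by rw [(Finset.mem_filter.mp hi).2] :
      ∀ i ∈ Z.filter (fun i => k i = a), g (k i) = g a), Finset.sum_const, nsmul_eq_mul]
  have hdouble : ∑ i ∈ Z, ∑ j ∈ Z, e (k i) (k j) = ∑ a, ∑ b, N a * N b * e a b := by
    rw [hfib (fun a => ∑ j ∈ Z, e a (k j))]
    refine Finset.sum_congr rfl fun a _ => ?_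
    rw [hfib (fun b => e a b), Finset.mul_sum]
    exact Finset.sum_congr rfl fun b _ => by ring
  have hcardZ : (Z.card : ℝ) = ∑ a, N a := by
    rw [hN, Finset.card_eq_sum_card_fiberwise (f := k) (s := Z) (t := Finset.univ)
      (fun i _ => Finset.mem_coe.mpr (Finset.mem_univ _))]
    push_cast
    rfl
  rw [hrew, hdouble, hcardZ]
  exact sq_sum_div_le_sum_sum_mul_mul_periodizedBernoulli N


/-! ### Petsche's Lemma 3 in abstract form: counting over the cosets of `E₀` -/

section Abstract

variable {G : Type*} [AddCommGroup G] [DecidableEq G]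

omit [DecidableEq G] in
/-- **Counting pairs in the same coset** (Petsche 2006, proof of Lemma 3, display (15):
`M = Σ_C N_C² ≥ N²/c_v`). For a subgroup `H` of finite index dividing `c ≠ 0` and a finite set `Z`,
the number of ordered pairs `(P, Q) ∈ Z × Z` with `P − Q ∈ H` is at least `|Z|²/c`.
[cite: Petsche2006, proof of Lemma 3, (15)] -/
theorem card_sq_div_le_card_filter_sub_mem (H : AddSubgroup G) {c : ℕ} (hc : c ≠ 0)
    (hHc : H.index ∣ c) (Z : Finset G) :
    (Z.card : ℝ) ^ 2 / c ≤
      ∑ P ∈ Z, ∑ Q ∈ Z, if P - Q ∈ H then (1 : ℝ) else 0 := by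
  have hidx : H.index ≠ 0 := fun h0 => hc (Nat.eq_zero_of_zero_dvd (h0 ▸ hHc))
  haveI : Fintype (G ⧸ H) := AddSubgroup.fintypeOfIndexNeZero hidx
  have hcpos : (0 : ℝ) < c := Nat.cast_pos.mpr (Nat.pos_of_ne_zero hc)
  -- fibres of the projection `π : G → G/H`
  set π : G → G ⧸ H := fun g => (g : G ⧸ H) with hπ
  set n : G ⧸ H → ℝ := fun γ => ((Z.filter fun P => π P = γ).card : ℝ) with hn
  have hmem : ∀ P Q : G, P - Q ∈ H ↔ π P = π Q := fun P Q => by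
    show P - Q ∈ H ↔ (P : G ⧸ H) = Q
    rw [QuotientAddGroup.eq, neg_add_eq_sub, ← neg_sub P Q, H.neg_mem_iff]
  have hfib : ∀ g : G ⧸ H → ℝ, ∑ P ∈ Z, g (π P) = ∑ γ, n γ * g γ := fun g => by
    rw [← Finset.sum_fiberwise_of_maps_to (s := Z) (t := Finset.univ) (g := π)
      (fun i _ => Finset.mem_univ _)]
    refine Finset.sum_congr rfl fun γ _ => ?_
    rw [Finset.sum_congr rfl (fun P hP => by rw [(Finset.mem_filter.mp hP).2] :
      ∀ P ∈ Z.filter (fun P => π P = γ), g (π P) = g γ), Finset.sum_const, nsmul_eq_mul]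
  have hinner : ∀ P : G, (∑ Q ∈ Z, if P - Q ∈ H then (1 : ℝ) else 0) = n (π P) := fun P => by
    simp_rw [hmem]
    rw [Finset.sum_boole, hn]
    simp only
    congr 2
    ext Q
    simp only [Finset.mem_filter, eq_comm]
  have hM : (∑ P ∈ Z, ∑ Q ∈ Z, if P - Q ∈ H then (1 : ℝ) else 0) = ∑ γ, n γ ^ 2 := by
    simp_rw [hinner]
    rw [hfib n]
    exact Finset.sum_congr rfl fun γ _ => by ring
  have hcardZ : (Z.card : ℝ) = ∑ γ, n γ := by
    rw [hn, Finset.card_eq_sum_card_fiberwise (f := π) (s := Z) (t := Finset.univ)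
      (fun i _ => Finset.mem_coe.mpr (Finset.mem_univ _))]
    push_cast
    rfl
  -- Cauchy–Schwarz: `(Σ n_γ)² ≤ #(G/H) Σ n_γ² = index · Σ n_γ² ≤ c Σ n_γ²`
  have hCS : (∑ γ, n γ) ^ 2 ≤ (H.index : ℝ) * ∑ γ, n γ ^ 2 := by
    have h := sq_sum_le_card_mul_sum_sq (s := (Finset.univ : Finset (G ⧸ H))) (f := n)
    rwa [Finset.card_univ, ← Nat.card_eq_fintype_card, ← AddSubgroup.index_eq_card] at h
  have hle : (H.index : ℝ) ≤ c := by exact_mod_cast Nat.le_of_dvd (Nat.pos_of_ne_zero hc) hHc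
  have hsum0 : 0 ≤ ∑ γ, n γ ^ 2 := Finset.sum_nonneg fun γ _ => sq_nonneg _
  rw [hM, hcardZ, div_le_iff₀ hcpos]
  calc (∑ γ, n γ) ^ 2 ≤ (H.index : ℝ) * ∑ γ, n γ ^ 2 := hCS
    _ ≤ c * ∑ γ, n γ ^ 2 := mul_le_mul_of_nonneg_right hle hsum0
    _ = (∑ γ, n γ ^ 2) * c := mul_comm _ _

/-- **Petsche 2006, Lemma 3, abstract form** (the counting-and-Fourier argument of its proof,
pp. 260–261, separated from the local height theory). Let `G` be an abelian group (the Mordell–Weil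
group `E(k)`), `H ≤ G` a subgroup ("the points of `E₀(k_v)`") whose index divides `c ≠ 0`
(`c = c_v = |E(k_v)/E₀(k_v)|`), `λ : G → ℝ` ("`λ_v`"), and `0 ≤ J ≤ L` (`J = log⁺|j_E|_v`,
`L = log|1/Δ_v|_v`). Assume
* `λ(g) ≥ L/12` for `g ∈ H ∖ {0}` (ATAEC VI.4.1: `i_v ≥ (1/12)(log|1/Δ_v|_v − log⁺|j_E|_v)` on `E₀`
  plus `j_v = (1/12) log⁺|j_E|_v` there), and
* for a homomorphism `r : G → ℝ/ℤ` vanishing on `H`, `λ(g) ≥ ½ 𝐁₂(r(g)) J` for all `g ≠ 0`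
  (`λ_v = i_v + j_v`, `i_v ≥ 0`, `j_v = ½ B₂(r(·)) log⁺|j_E|_v`; for `|j_E|_v ≤ 1` take `J = 0`,
  `r = 0`).
Then for every non-empty finite `Z ⊆ G` with `N = |Z|`,
`(1/c² − 1/N) L/12 ≤ N⁻² Σ_{P ≠ Q ∈ Z} λ(P − Q)`, i.e. `Λ_v(Z) ≥ (1/c_v² − 1/N)(1/12) log|1/Δ_v|_v`.
Proof as printed: the pairs with `P − Q ∈ H` number `M ≥ N²/c` (display (15)) and contribute
`≥ (M − N)(L − J)/12` beyond their `j`-part; the `j`-parts of all pairs sum to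
`≥ (N²/c² − N) J/12` by the positivity of the `𝐁₂`-kernel on `⟨1/c⟩ ⊂ ℝ/ℤ` (display (18), here
`card_sq_div_le_sum_sum_periodizedBernoulli`, using `c • r = 0` since `c • G ⊆ H`); finally
`1/c ≥ 1/c²` and `L ≥ J`. [cite: Petsche2006, Lemma 3] -/
theorem lemma3_abstract (H : AddSubgroup G) {c : ℕ} (hc : c ≠ 0) (hHc : H.index ∣ c)
    (lam : G → ℝ) {L J : ℝ} (hJ : 0 ≤ J) (hJL : J ≤ L)
    (hH : ∀ g ∈ H, g ≠ 0 → L / 12 ≤ lam g)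
    (r : G →+ UnitAddCircle) (hr : ∀ g ∈ H, r g = 0)
    (hB : ∀ g : G, g ≠ 0 → 1 / 2 * periodizedBernoulli 2 (r g) * J ≤ lam g)
    (Z : Finset G) (hZ : Z.Nonempty) :
    (1 / (c : ℝ) ^ 2 - 1 / Z.card) * (L / 12) ≤
      1 / (Z.card : ℝ) ^ 2 * ∑ P ∈ Z, ∑ Q ∈ Z.erase P, lam (P - Q) := by
  have hidx : H.index ≠ 0 := fun h0 => hc (Nat.eq_zero_of_zero_dvd (h0 ▸ hHc))
  set N : ℝ := (Z.card : ℝ) with hNdef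
  have hNpos : 0 < N := by rw [hNdef]; exact_mod_cast hZ.card_pos
  have hcpos : (0 : ℝ) < c := Nat.cast_pos.mpr (Nat.pos_of_ne_zero hc)
  have hc1 : (1 : ℝ) ≤ c := by exact_mod_cast Nat.one_le_iff_ne_zero.mpr hc
  -- `c • g ∈ H`, hence `c • r g = 0`, for every `g`
  have hcr : ∀ g : G, c • r g = 0 := fun g => by
    obtain ⟨m, hm⟩ := hHc
    rw [← map_nsmul]
    apply hr
    rw [hm, mul_nsmul]
    exact H.nsmul_mem (H.nsmul_index_mem g) m
  -- pointwise bound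
  have hpt : ∀ P Q : G, P ≠ Q →
      (if P - Q ∈ H then (L - J) / 12 else 0) + 1 / 2 * periodizedBernoulli 2 (r P - r Q) * J ≤
        lam (P - Q) := by
    intro P Q hPQ
    have hne : P - Q ≠ 0 := sub_ne_zero.mpr hPQ
    rw [← map_sub]
    split_ifs with hmem
    · rw [hr _ hmem, periodizedBernoulli_two_zero]
      have := hH _ hmem hne
      linarith
    · rw [zero_add]
      exact hB _ hne
  -- sum the pointwise bound over ordered pairs of distinct points
  have hsum : ∑ P ∈ Z, ∑ Q ∈ Z.erase P,
      ((if P - Q ∈ H then (L - J) / 12 else 0) + 1 / 2 * periodizedBernoulli 2 (r P - r Q) * J) ≤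
        ∑ P ∈ Z, ∑ Q ∈ Z.erase P, lam (P - Q) :=
    Finset.sum_le_sum fun P _ => Finset.sum_le_sum fun Q hQ =>
      hpt P Q (Finset.ne_of_mem_erase hQ).symm
  -- evaluate the left-hand side: erase the diagonal
  have hA : ∑ P ∈ Z, ∑ Q ∈ Z.erase P, (if P - Q ∈ H then (L - J) / 12 else 0) =
      (L - J) / 12 * ((∑ P ∈ Z, ∑ Q ∈ Z, if P - Q ∈ H then (1 : ℝ) else 0) - N) := by
    have : ∀ P ∈ Z, ∑ Q ∈ Z.erase P, (if P - Q ∈ H then (L - J) / 12 else 0) =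
        (L - J) / 12 * ((∑ Q ∈ Z, if P - Q ∈ H then (1 : ℝ) else 0) - 1) := fun P hP => by
      rw [Finset.sum_erase_eq_sub hP, sub_self, if_pos H.zero_mem, mul_sub, mul_one,
        Finset.mul_sum]
      congr 1
      exact Finset.sum_congr rfl fun Q _ => by split_ifs <;> simp
    rw [Finset.sum_congr rfl this, ← Finset.mul_sum, Finset.sum_sub_distrib, Finset.sum_const,
      nsmul_eq_mul, mul_one]
  have hBsum : ∑ P ∈ Z, ∑ Q ∈ Z.erase P, 1 / 2 * periodizedBernoulli 2 (r P - r Q) * J =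
      J / 2 * ((∑ P ∈ Z, ∑ Q ∈ Z, periodizedBernoulli 2 (r P - r Q)) - N / 6) := by
    have : ∀ P ∈ Z, ∑ Q ∈ Z.erase P, 1 / 2 * periodizedBernoulli 2 (r P - r Q) * J =
        J / 2 * ((∑ Q ∈ Z, periodizedBernoulli 2 (r P - r Q)) - 1 / 6) := fun P hP => by
      rw [Finset.sum_erase_eq_sub hP, sub_self, periodizedBernoulli_two_zero, mul_sub,
        Finset.mul_sum]
      congr 1
      · exact Finset.sum_congr rfl fun Q _ => by ring
      · ring
    rw [Finset.sum_congr rfl this, ← Finset.mul_sum, Finset.sum_sub_distrib, Finset.sum_const,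
      nsmul_eq_mul]
    ring
  have hM := card_sq_div_le_card_filter_sub_mem H hc hHc Z
  haveI : NeZero c := ⟨hc⟩
  have hF := card_sq_div_le_sum_sum_periodizedBernoulli (c := c) Z (fun P => r P) fun P _ => hcr P
  rw [← hNdef] at hM hF
  have hLJ : 0 ≤ L - J := sub_nonneg.mpr hJL
  -- the main chain of inequalities
  have hsplit : ∑ P ∈ Z, ∑ Q ∈ Z.erase P,
      ((if P - Q ∈ H then (L - J) / 12 else 0) + 1 / 2 * periodizedBernoulli 2 (r P - r Q) * J) =
      (∑ P ∈ Z, ∑ Q ∈ Z.erase P, (if P - Q ∈ H then (L - J) / 12 else 0)) +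
        ∑ P ∈ Z, ∑ Q ∈ Z.erase P, 1 / 2 * periodizedBernoulli 2 (r P - r Q) * J := by
    rw [← Finset.sum_add_distrib]
    exact Finset.sum_congr rfl fun P _ => Finset.sum_add_distrib
  have h3 : N ^ 2 / c ^ 2 ≤ N ^ 2 / c := by
    rw [div_le_div_iff₀ (by positivity) hcpos]
    calc N ^ 2 * c = N ^ 2 * c * 1 := (mul_one _).symm
      _ ≤ N ^ 2 * c * c := by gcongr
      _ = N ^ 2 * c ^ 2 := by ring
  have hkey : (N ^ 2 / c ^ 2 - N) * (L / 12) ≤ ∑ P ∈ Z, ∑ Q ∈ Z.erase P, lam (P - Q) :=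
    calc (N ^ 2 / c ^ 2 - N) * (L / 12)
        = (L - J) / 12 * (N ^ 2 / c ^ 2 - N) + J / 2 * (N ^ 2 / (6 * c ^ 2) - N / 6) := by ring
      _ ≤ (L - J) / 12 * ((∑ P ∈ Z, ∑ Q ∈ Z, if P - Q ∈ H then (1 : ℝ) else 0) - N) +
            J / 2 * ((∑ P ∈ Z, ∑ Q ∈ Z, periodizedBernoulli 2 (r P - r Q)) - N / 6) := by
          have h1 : (L - J) / 12 * (N ^ 2 / c ^ 2 - N) ≤
              (L - J) / 12 * ((∑ P ∈ Z, ∑ Q ∈ Z, if P - Q ∈ H then (1 : ℝ) else 0) - N) :=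
            mul_le_mul_of_nonneg_left (by linarith [hM, h3]) (by positivity)
          have h2 : J / 2 * (N ^ 2 / (6 * c ^ 2) - N / 6) ≤
              J / 2 * ((∑ P ∈ Z, ∑ Q ∈ Z, periodizedBernoulli 2 (r P - r Q)) - N / 6) :=
            mul_le_mul_of_nonneg_left (by linarith [hF]) (by positivity)
          linarith
      _ = ∑ P ∈ Z, ∑ Q ∈ Z.erase P, ((if P - Q ∈ H then (L - J) / 12 else 0) +
            1 / 2 * periodizedBernoulli 2 (r P - r Q) * J) := by rw [hsplit, hA, hBsum]
      _ ≤ ∑ P ∈ Z, ∑ Q ∈ Z.erase P, lam (P - Q) := hsum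
  -- divide by `N²`
  have hN2 : 0 < N ^ 2 := by positivity
  calc (1 / (c : ℝ) ^ 2 - 1 / N) * (L / 12)
      = 1 / N ^ 2 * ((N ^ 2 / c ^ 2 - N) * (L / 12)) := by
        field_simp
    _ ≤ 1 / N ^ 2 * ∑ P ∈ Z, ∑ Q ∈ Z.erase P, lam (P - Q) := by gcongr

end Abstract


end Petsche2006

/-! ### The named fact `Petsche2006_lemma3` from the local structure at each finite place -/

open IsDedekindDomain Rat.HeightOneSpectrum _root_.WeierstrassCurve _root_.WeierstrassCurve.Affine.Point

/-- **Petsche 2006, Lemma 3 over `ℚ`, reduced to the local height theory** (Petsche's proof,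
arXiv math/0508160 pp. 5–6, run through `Petsche2006.lemma3_abstract`). Suppose that for every
elliptic curve `W/ℚ` and every finite place `v` (`p = p_v`, `c_v = W.tamagawaNumberAt v`,
`L = ord_v(Δ_min) log p = log|1/Δ_v|_v`, `λ_v = neronLocalHeight (padicAbv v)`) there are a
subgroup `H ≤ E(ℚ)` whose index divides `c_v` (the rational points with nonsingular reduction on
the local minimal model: `E(ℚ)/H ↪ E(ℚ_v)/E₀(ℚ_v)`), a real number `0 ≤ J ≤ L`
(`J = log⁺|j_E|_v`; `J ≤ L` because `j = c₄³/Δ` with `c₄` integral) and a homomorphism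
`r : E(ℚ) → ℝ/ℤ` vanishing on `H`, such that `λ_v(P) ≥ L/12` for `P ∈ H ∖ {O}` (ATAEC VI.4.1) and
`λ_v(P) ≥ ½ 𝐁₂(r(P)) J` for all `P ≠ O` (Petsche's `λ_v = i_v + j_v`, `i_v ≥ 0`, displays
(11)–(12): Tate's uniformisation for `|j_E|_v > 1`, and `λ_v ≥ 0` for `|j_E|_v ≤ 1`). Then
Petsche's Lemma 3 holds at every finite place of `ℚ` for rational points
(`Petsche2006_lemma3`). [cite: Petsche2006, Lemma 3] -/
theorem Petsche2006_lemma3_of_localStructure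
    (hloc : ∀ (W : WeierstrassCurve ℚ) [W.IsElliptic] (v : HeightOneSpectrum ℤ),
      ∃ (H : AddSubgroup W.toAffine.Point) (r : W.toAffine.Point →+ UnitAddCircle) (J : ℝ),
        H.index ∣ W.tamagawaNumberAt v ∧ 0 ≤ J ∧
        J ≤ (W.ordMinimalDiscriminant v : ℝ) * Real.log (natGenerator v) ∧
        (∀ P ∈ H, P ≠ 0 →
          1 / 12 * ((W.ordMinimalDiscriminant v : ℝ) * Real.log (natGenerator v)) ≤
            P.neronLocalHeight (padicAbv v)) ∧
        (∀ P ∈ H, r P = 0) ∧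
        ∀ P : W.toAffine.Point, P ≠ 0 →
          1 / 2 * periodizedBernoulli 2 (r P) * J ≤ P.neronLocalHeight (padicAbv v)) :
    Petsche2006_lemma3 := by
  intro W _ v Z hZ
  obtain ⟨H, r, J, hHc, hJ0, hJL, hH, hr, hB⟩ := hloc W v
  -- `c_v ≠ 0` (Kodaira–Néron finiteness for the finite residue field `𝔽_p`)
  have hc : W.tamagawaNumberAt v ≠ 0 := by
    haveI : PerfectField (IsLocalRing.ResidueField (v.adicCompletionIntegers ℚ)) :=
      PerfectField.ofFinite
    haveI := W.isElliptic_localMinimalModel v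
    exact (W.localMinimalModel v).index_goodReductionSubgroup_ne_zero_of_finite_residueField _
  have h := Petsche2006.lemma3_abstract H hc hHc (fun P : W.toAffine.Point => P.neronLocalHeight (padicAbv v))
    hJ0 hJL (fun P hP hP0 => by
      have := hH P hP hP0
      linarith) r hr hB Z hZ
  rw [Petsche2006.localHeightDiscSum]
  calc (1 / (W.tamagawaNumberAt v : ℝ) ^ 2 - 1 / (Z.card : ℝ)) *
        (1 / 12 * ((W.ordMinimalDiscriminant v : ℝ) * Real.log (natGenerator v)))
      = (1 / (W.tamagawaNumberAt v : ℝ) ^ 2 - 1 / (Z.card : ℝ)) *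
        (((W.ordMinimalDiscriminant v : ℝ) * Real.log (natGenerator v)) / 12) := by ring
    _ ≤ _ := h

end Literature.NumberTheory.EllipticCurves

end
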